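/-
Copyright: the b2b-balaban cell (near-miss cell 7), T⁴-continuum fan-out, lineage t4-ne7b-p3 (node U5c LARGE-DEVIATION
member P3).  Released under the licence of the surrounding project.
-/
import Summits.QuantumFields.BalabanUV.T4Continuum.Support.SpaceTimeOccBridge
import Summits.QuantumFields.BalabanUV.T4Continuum.Support.SpaceTimeCells
import Summits.QuantumFields.BalabanUV.T4Continuum.Support.SpaceTimePinningK
import Summits.QuantumFields.BalabanUV.T4Continuum.Support.SpaceTimeVolume
import Summits.QuantumFields.BalabanUV.T4Continuum.Support.SpaceTimeThreshold

/-!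
# Space-time Peierls ∕ Cramér route for NE7b — THE ASSEMBLY OVER NAMED READINGS (skeleton row ST12): the lineage
# readings of one run ⇒ `OccLeaves`; two runs + the (B)-denominator + survival ⇒ NE7b's output shape `RelWeightBound`

Summits-side support leaf of the T⁴-continuum cell (rung (B)+1 on a FINITE torus only; NOT infinite volume, NOT the
mass gap, NOT the Clay statement; NOT a proof of the spine estimate NE7b).  Lineage `t4-ne7b-p3` (generation 2), node
U5c, skeleton `t4/skeletons/NE7b-t4-ne7b-p3.md` row ST12.  [folklore] composition of this lineage's landed modules
(`SpaceTimeOccBridge`, `SpaceTimeCells`, `SpaceTimePinningK`, `SpaceTimeVolume`, `SpaceTimeBankedRate`,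
`SpaceTimeThreshold`) over the row's shared carrier (`T4PersistenceDictionary.Gen`, `T4PrintedShapeBanking`, lineage
t4-ne7b-p1, BY NAME); nothing is quoted from print and nothing printed is asserted; no `[cite:]` tag.

WHAT.  `structure LineageReadings` DISPLAYS, as fields over an occupancy model `M` of ONE run at one `(K, t)`, exactly
what the CONTOUR route reads off Bałaban's inductive description and does not prove (the honest residue of the skeleton,
§3 (c)): the entropy data of the cell complex (`deg`, `animal`, `anchors` — DISCHARGED on the torus cell model by
`SpaceTimeCells`, §3), positivity (I-2), the contour cover of the bad class (A2c over the occupancy reading A2b), and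
the LINEAGE data: for every term `τ` and every contour `𝒦` of it, a genealogy `gen τ 𝒦` of the final live component
whose lineage `𝒦` is — consistent and well-formed ((ID)), pending at a cut `tcut ≤ reach` — with the per-structure-
step CELL binder `#𝒦 ≤ cA·treeD + cB·treeSteps` (A2b, volume side), the FACTORISATION binder
`A τ ≤ e^{−(credits − lifeCost)(gen τ 𝒦)} · rest 𝒦 τ` (A3a ∧ A3e: the lineage's raw banked factor splits off) and the
REMAINDER binder `Σ_{τ pinned by 𝒦} rest 𝒦 τ ≤ (e^{c₃})^{#𝒦}·nup` (A3f multiplicity × A3e (B)-machinery junction —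
NOT PRINTED as a statement).
* §1 `pinnedContourBound_of_readings`: the readings + the COUNT member's `Banking` along the run (displayed; in the
  tree past one infrared threshold, `SpaceTimeThreshold.survival_and_irThreshold`) ⇒ leaf A3
  `PinnedContourBound A (e^{−(rateB − c₃)}) nup`, through `SpaceTimeVolume.volumeAccounting_of_consistent`,
  `SpaceTimeBankedRate.surplus_ge_rateB_printedShape`, `SpaceTimePinning.factor_of_surplusK` ∕
  `pinnedContourBound_of_splitK`;
* §2 `occLeaves_of_readings` (⇒ `SpaceTimeOccBridge.OccLeaves`, the cutoff `Kc` of the run's genealogies existential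
  — `K` for run A, `K + 1` for run B) and **`exists_relWeightBound_of_readings`**: both runs' readings from `K₀` on,
  `LowEnvelope` ×2 with a common constant (A4, the pinned (B) through `T4StabilitySocket`), `j⋆(K) ≤ K`, the
  matching-scale fraction `c·K ≤ K − j⋆(K)` and the SURVIVAL MARGIN `log Δ₁ + c₃ < rateB` give NE7b's output shape
  `RelWeightBound` — THE END OF THE ROUTE WITH EVERY READING A NAMED FIELD;
* §3 the entropy fields on the torus cell complex `STCell d n L K'` (`deg`, `animal`, `anchors ≤ (n·L^{K'−K})^d`).
Honest residue after this file = the fields `cover`, `lineage` (consistency ∕ cells ∕ factorisation ∕ remainder) of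
`LineageReadings` for Bałaban's expansion + the COUNT member's `Banking` from the typed flow (BetaPertH behind it) + (B)
inside `LowEnvelope`.  NE7b is NOT proved by this file.

HONEST DEPENDENCY (cell, verbatim): continuum YM on T⁴ ⇐ BetaPertH ∧ nine spine estimates (0/9 proved); BetaPertH ⇐
(D1) ∧ (D4) ∧ CAP+tail; G-an2-4 gates asym, D1 and NE2/3/4.  This file changes none of it.
-/

open Finset

namespace Summit.QuantumFields.BalabanUV.T4Continuum.SpaceTimePeierls

open Literature.MathematicalPhysics.QuantumFieldTheory.Balaban1983to89
open T4WeightBudget T4StabilitySocket T4PersistenceDictionary T4BankedInduction T4PrintedShapeBanking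
open SpaceTimePeierlsLeaves

noncomputable section

/-! ## §1 The lineage readings of one run and the pinned-contour bound -/

section OneRun

variable {ι : Type*} {Cell : Type} [Fintype Cell]

open Classical in
/-- **THE LINEAGE READINGS** of ONE run at one `(K, t)` over an occupancy model `M` (terms, occupied cells, adjacency,
scale), for printed-shape constants `C`, genealogy cutoff `Kc`, flow run `(R, g)`, weights `A`, bad class `Bad`, window
floor `jlo`, envelope `nup`, entropy constants `Δ, Δ₁, Nanc`, cell constants `cA, cB, dC` and multiplicity `c₃`.
Fields = the skeleton's displayed binders: `deg`∕`animal`∕`anchors` (entropy of the cell complex; discharged on the torus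
model, §3), `nonneg` (I-2), `cover` (A2c over A2b), `lineage` (A2b∕(ID)∕A3a∕A3e∕A3f: genealogy of the pinned lineage —
consistent, well-formed, pending at the cut; cell binder; factorisation of the raw banked factor; remainder bound).
A hypothesis shape about Bałaban's expansion when instantiated on it; nothing asserted here. [folklore] -/
structure LineageReadings (M : OccModel ι Cell) [DecidableRel M.Adj.Adj] (C : T4PrintedShapeBanking.Consts)
    (K Kc : ℕ) (R : ℕ → ℕ) (g : ℕ → ℝ) (A : ι → ℝ) (Bad : Finset ι) (jlo : ℕ) (nup : ℝ) (Δ : ℕ)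
    (Δ₁ Nanc cA cB dC c₃ : ℝ) : Prop where
  /-- entropy: degree bound of the space-time adjacency -/
  deg : ∀ c, M.Adj.degree c ≤ Δ
  /-- entropy: site animals (leaf A1) -/
  animal : SiteAnimalBound Δ Δ₁
  /-- entropy: the anchors (cells of the final scale `K`) -/
  anchors : (((univ : Finset Cell).filter fun c => M.scale c = K).card : ℝ) ≤ Nanc
  /-- I-2: nonnegative weights -/
  nonneg : ∀ τ ∈ M.T, 0 ≤ A τ
  /-- A2c: every bad term has a contour meeting every scale of `[jlo, K]` -/
  cover : M.ContourCover Bad jlo K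
  /-- A2b ∕ (ID) ∕ A3a ∕ A3e ∕ A3f: the lineage data of every pinned contour -/
  lineage : ∃ (gen : ι → Finset Cell → Gen PEv) (rest : Finset Cell → ι → ℝ) (tcut : ι → Finset Cell → ℕ),
    (∀ (𝒦 : Finset Cell), ∀ τ ∈ M.T, M.IsContour τ 𝒦 →
        Consistent C Kc R (gen τ 𝒦) ∧ (gen τ 𝒦).WF (dictW R C.n₁) ∧
        tcut τ 𝒦 ≤ (gen τ 𝒦).reach (dictW R C.n₁) ∧
        (𝒦.card : ℝ) ≤ cA * treeD PEv.fat PEv.step dC (gen τ 𝒦) (tcut τ 𝒦) +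
          cB * treeSteps PEv.step (gen τ 𝒦) (tcut τ 𝒦) ∧
        A τ ≤ Real.exp (-(credits (credit C g) (gen τ 𝒦) - lifeCost (dictW R C.n₁) (cost C Kc R) (gen τ 𝒦))) *
          rest 𝒦 τ) ∧
    (∀ (𝒦 : Finset Cell), ∀ τ ∈ M.T, 0 ≤ rest 𝒦 τ) ∧
    (∀ (𝒦 : Finset Cell), ∑ τ ∈ M.T.filter (fun τ => M.IsContour τ 𝒦), rest 𝒦 τ ≤ Real.exp c₃ ^ 𝒦.card * nup)

variable {M : OccModel ι Cell} [DecidableRel M.Adj.Adj] {C : T4PrintedShapeBanking.Consts} {K Kc : ℕ} {R : ℕ → ℕ}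
  {g : ℕ → ℝ} {A : ι → ℝ} {Bad : Finset ι} {jlo : ℕ} {nup : ℝ} {Δ : ℕ} {Δ₁ Nanc cA cB dC c₃ : ℝ}

/-- **LEAF A3 FROM THE READINGS AND THE COUNT MEMBER's BANKING.**  The lineage readings of a run, print's banking
binders along the run's flow at the COUNT member's bank (displayed hypothesis `B`; in the tree past one infrared
threshold), valid constants with `0 ≤ A₀`, a nonnegative profile on performed steps and positive cell constants give the
PINNED-CONTOUR BOUND with price `e^{−(rateB − c₃)}`:
`Σ_{τ pinned by 𝒦} A τ ≤ (e^{−(rateB − c₃)})^{#𝒦} · nup`, `rateB = rateB κ₁ Eb μ (2cA) (cB + 2cA·dC)`. [folklore] -/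
theorem pinnedContourBound_of_readings
    (h : LineageReadings M C K Kc R g A Bad jlo nup Δ Δ₁ Nanc cA cB dC c₃) (hC : C.Valid) (hA0 : 0 ≤ C.A₀)
    (hx0 : ∀ s, s ≤ Kc → 0 ≤ Real.log ((g s) ^ 2)⁻¹)
    (B : Banking (Consistent C Kc R) (dictW R C.n₁) (cost C Kc R) (credit C g)
      (fun e => C.κ₁ * ((dictW R C.n₁ e : ℕ) : ℝ) + Emarg C e) (reserve C g) (extn C Kc R))
    (hcA : 0 < cA) (hcB : 0 < cB) (hdC : 0 ≤ dC) :
    M.PinnedContourBound A (Real.exp (-(rateB C.κ₁ C.Eb C.μ (2 * cA) (cB + 2 * cA * dC) - c₃))) nup := by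
  classical
  obtain ⟨gen, rest, tcut, hlin, hrest, hrem⟩ := h.lineage
  have hC₁ : 0 < 2 * cA := by positivity
  have hC₂ : 0 < cB + 2 * cA * dC := by positivity
  -- the factor half from the banked rate of the pinned lineage
  have hfac := factor_of_surplusK (M := M) (A := A) (rest := rest)
    (S := fun 𝒦 τ => credits (credit C g) (gen τ 𝒦) - lifeCost (dictW R C.n₁) (cost C Kc R) (gen τ 𝒦))
    (s := rateB C.κ₁ C.Eb C.μ (2 * cA) (cB + 2 * cA * dC)) hrest
    (fun 𝒦 τ hτ hc => (hlin 𝒦 τ hτ hc).2.2.2.2)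
    (fun 𝒦 τ hτ hc => by
      obtain ⟨hcons, hwf, hcut, hcells, -⟩ := hlin 𝒦 τ hτ hc
      exact surplus_ge_rateB_printedShape hC B hA0 hx0 hC₁ hC₂ hcons hwf
        (volumeAccounting_of_consistent (cost := cost C Kc R) (credit := credit C g) hcA.le hcB.le hdC hcons hwf
          hcut hcells))
  have hsplit : M.PinnedSplitK A rest (Real.exp (-rateB C.κ₁ C.Eb C.μ (2 * cA) (cB + 2 * cA * dC)))
      (Real.exp c₃) nup :=
    ⟨hrest, hfac, hrem⟩
  have key := OccModel.pinnedContourBound_of_splitK hsplit (Real.exp_nonneg _)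
  have hq : Real.exp (-rateB C.κ₁ C.Eb C.μ (2 * cA) (cB + 2 * cA * dC)) * Real.exp c₃ =
      Real.exp (-(rateB C.κ₁ C.Eb C.μ (2 * cA) (cB + 2 * cA * dC) - c₃)) := by
    rw [← Real.exp_add]
    congr 1
    ring
  rw [hq] at key
  exact key

end OneRun

/-! ## §2 The readings ⇒ `OccLeaves`; two runs ⇒ NE7b's output shape -/

section End

variable {ι : Type*} [DecidableEq ι] {l₀ : ℝ} {T : ℕ → Finset ι} {A B : ℕ → ℝ → ι → ℝ}
  {Bad : ℕ → ℝ → Finset ι} {nup mup nlow mlow : ℕ → ℝ → ℝ} {Cst : ℝ} {K₀ : ℕ} {jstar : ℕ → ℕ}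
  {C : T4PrintedShapeBanking.Consts} {Δ₁ Nanc cA cB dC c₃ : ℝ}

/-- NAMED SHAPE `RunReadings C T X Bad xup jstar Δ₁ Nanc cA cB dC c₃ K t` (ONE run, ONE `(K, t)`): on SOME finite
occupancy model of the run's terms `T K`, for SOME genealogy cutoff `Kc` and flow run `(R, g)` with a nonnegative
profile on performed steps and print's banking at the COUNT member's bank (the tree's `exists_irThreshold`, past the
infrared threshold), the lineage readings hold.  A hypothesis shape; nothing asserted. [folklore] -/
def RunReadings (C : T4PrintedShapeBanking.Consts) (T : ℕ → Finset ι) (X : ℕ → ℝ → ι → ℝ)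
    (Bad : ℕ → ℝ → Finset ι) (xup : ℕ → ℝ → ℝ) (jstar : ℕ → ℕ) (Δ₁ Nanc cA cB dC c₃ : ℝ) (K : ℕ) (t : ℝ) :
    Prop :=
  ∃ (Cell : Type) (_ : Fintype Cell) (_ : DecidableEq Cell) (M : OccModel ι Cell) (_ : DecidableRel M.Adj.Adj)
    (Δ Kc : ℕ) (R : ℕ → ℕ) (g : ℕ → ℝ),
    M.T = T K ∧ (∀ s, s ≤ Kc → 0 ≤ Real.log ((g s) ^ 2)⁻¹) ∧
    Banking (Consistent C Kc R) (dictW R C.n₁) (cost C Kc R) (credit C g)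
      (fun e => C.κ₁ * ((dictW R C.n₁ e : ℕ) : ℝ) + Emarg C e) (reserve C g) (extn C Kc R) ∧
    LineageReadings M C K Kc R g (X K t) (Bad K t) (jstar K) (xup K t) Δ Δ₁ Nanc cA cB dC c₃

omit [DecidableEq ι] in
/-- **THE READINGS OF A RUN GIVE ITS `OccLeaves`** (A1 ∧ A2c ∧ A3 ∧ I-2 on an occupancy model) with the survival
exponent `s₁ = rateB − c₃`. [folklore] -/
theorem occLeaves_of_readings (hC : C.Valid) (hA0 : 0 ≤ C.A₀) (hcA : 0 < cA) (hcB : 0 < cB) (hdC : 0 ≤ dC)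
    {X : ℕ → ℝ → ι → ℝ} {xup : ℕ → ℝ → ℝ} {K : ℕ} {t : ℝ}
    (h : RunReadings C T X Bad xup jstar Δ₁ Nanc cA cB dC c₃ K t) :
    OccLeaves T X Bad xup jstar Nanc Δ₁ (rateB C.κ₁ C.Eb C.μ (2 * cA) (cB + 2 * cA * dC) - c₃) K t := by
  obtain ⟨Cell, hF, hD, M, hR, Δ, Kc, R, g, hT, hx0, B, hL⟩ := h
  refine ⟨Cell, hF, hD, M, hR, Δ, hT, hL.deg, hL.animal, hL.anchors, hL.cover, ?_, ?_⟩
  · exact pinnedContourBound_of_readings hL hC hA0 hx0 B hcA hcB hdC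
  · intro τ hτ
    exact hL.nonneg τ (hT ▸ hτ)

/-- **THE END OF THE CONTOUR ROUTE WITH EVERY READING A NAMED FIELD.**  For valid printed-shape constants (`0 ≤ A₀`)
and positive cell constants: the run readings (`RunReadings`: lineage readings + print's banking along the run's flow)
of run A and of run B at every `(K, t)` from `K₀` on, the denominators `LowEnvelope` with a common constant (A4: the
pinned (B) through the socket), `j⋆(K) ≤ K`, the matching-scale fraction `c·K ≤ K − j⋆(K)` (I-1), `Nanc ≥ 0`,
`Δ₁ > 0`, and the SURVIVAL MARGIN `log Δ₁ + c₃ < rateB` (`SpaceTimeThreshold`: banks at the survival rate) give NE7b's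
output shape: the bad classes emptied below some `K₁ ≥ K₀` carry the summable relative weight
`W = 𝟙_{K ≥ K₁}·Cst·Nanc·ϱ^{K−j⋆(K)+1}/(1−ϱ)`, `ϱ = Δ₁·e^{−(rateB − c₃)} < 1` — the `hW` binder of
`CountSeamJunction.hybridNE7_of_eventually`.  NOT a proof of NE7b: the readings, the banking's flow side and (B) stay
displayed. [folklore] -/
theorem exists_relWeightBound_of_readings (hC : C.Valid) (hA0 : 0 ≤ C.A₀) (hcA : 0 < cA) (hcB : 0 < cB)
    (hdC : 0 ≤ dC)
    (hRA : ∀ K t, |t| ≤ l₀ → K₀ ≤ K → RunReadings C T A Bad nup jstar Δ₁ Nanc cA cB dC c₃ K t)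
    (hRB : ∀ K t, |t| ≤ l₀ → K₀ ≤ K → RunReadings C T B Bad mup jstar Δ₁ Nanc cA cB dC c₃ K t)
    (hEA : LowEnvelope l₀ T A nlow nup Cst K₀) (hEB : LowEnvelope l₀ T B mlow mup Cst K₀) (hCst : 0 ≤ Cst)
    (hj : ∀ K, jstar K ≤ K) (hNanc : 0 ≤ Nanc) (hΔ₁ : 0 < Δ₁)
    (hsurv : Real.log Δ₁ + c₃ < rateB C.κ₁ C.Eb C.μ (2 * cA) (cB + 2 * cA * dC)) {c : ℝ} (hc : 0 < c)
    (hfrac : ∀ K : ℕ, c * K ≤ ((K - jstar K : ℕ) : ℝ)) :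
    ∃ K₁, K₀ ≤ K₁ ∧ RelWeightBound l₀ T A B (fun K t => if K₁ ≤ K then Bad K t else ∅)
      (Set.indicator {K | K₁ ≤ K} (fun K => Cst *
        contourBudget Nanc (Δ₁ * Real.exp (-(rateB C.κ₁ C.Eb C.μ (2 * cA) (cB + 2 * cA * dC) - c₃))) jstar K)) :=
  exists_relWeightBound_of_occLeaves
    (fun K t ht hK => occLeaves_of_readings hC hA0 hcA hcB hdC (hRA K t ht hK))
    (fun K t ht hK => occLeaves_of_readings hC hA0 hcA hcB hdC (hRB K t ht hK))
    hEA hEB hCst hj hNanc hΔ₁ (survives_of_lt hΔ₁ hsurv) hc hfrac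

end End

/-! ## §2b The same END with the typed flow in place of the banking (survival automatic) -/

section Flow

variable {ι : Type*} [DecidableEq ι]

/-- NAMED SHAPE `RunReadingsFlow C L r β₀ x₀ T X Bad xup jstar Δ₁ Nanc cA cB dC c₃ K t` (ONE run, ONE `(K, t)`): as
`RunReadings`, but with THE TYPED FLOW FACTS of the run in place of the banking — (2.7) `B14.FlowIneq27`, (2.9)
`B14FlowStep.FlowIneq29`, (2.5) `B14.IsRj` along the run, `1 ≤ log g_s⁻²`, and the infrared value `x₀ ≤ log g_{Kc}⁻²`
(BetaPertH behind them; the COUNT swarm's `HistoryFlow` supplies them along Bałaban's tuned runs).  A hypothesis shape;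
nothing asserted. [folklore] -/
def RunReadingsFlow (C : T4PrintedShapeBanking.Consts) (L r : ℕ) (β₀ x₀ : ℝ) (T : ℕ → Finset ι)
    (X : ℕ → ℝ → ι → ℝ) (Bad : ℕ → ℝ → Finset ι) (xup : ℕ → ℝ → ℝ) (jstar : ℕ → ℕ) (Δ₁ Nanc cA cB dC c₃ : ℝ)
    (K : ℕ) (t : ℝ) : Prop :=
  ∃ (Cell : Type) (_ : Fintype Cell) (_ : DecidableEq Cell) (M : OccModel ι Cell) (_ : DecidableRel M.Adj.Adj)
    (Δ Kc : ℕ) (R : ℕ → ℕ) (g : ℕ → ℝ) (β' : ℝ),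
    M.T = T K ∧ B14.FlowIneq27 g β' β₀ C.p₀ Kc ∧ B14FlowStep.FlowIneq29 R g L β' β₀ Kc ∧
    (∀ s, s ≤ Kc → B14.IsRj L r (g s) (R s)) ∧ (∀ s, s ≤ Kc → 1 ≤ Real.log ((g s) ^ 2)⁻¹) ∧
    x₀ ≤ Real.log ((g Kc) ^ 2)⁻¹ ∧
    LineageReadings M C K Kc R g (X K t) (Bad K t) (jstar K) (xup K t) Δ Δ₁ Nanc cA cB dC c₃

/-- **THE END OF THE CONTOUR ROUTE FROM THE READINGS AND THE TYPED FLOW — ONE INFRARED THRESHOLD, SURVIVAL AUTOMATIC.**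
For valid base constants `C₀` (`a, A₀ > 0`), block size `L ≥ 1`, `β₀ ≥ 0`, the exponent condition `r(q′+1) < p₀`, a
site-animal constant `Δ₁ > 0`, a multiplicity `c₃` and cell constants `cA, cB > 0`, `dC ≥ 0`, put the banks at the
survival rate: `C := withBanks C₀ (survivalRate Δ₁ c₃) (2cA) (cB + 2cA·dC)` (`SpaceTimeThreshold`).  THEN THERE IS ONE
NUMBER `x₀` — depending on these constants only, NOT on the cutoff, the runs or the terms — such that: for every
two-run family whose runs carry the lineage readings for `C` together with the typed flow facts and the infrared value
`log g_{Kc}⁻² ≥ x₀` at every `(K, t)` from `K₀` on (`RunReadingsFlow`), the denominators `LowEnvelope` with a common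
constant, `j⋆(K) ≤ K`, `Nanc ≥ 0` and the matching-scale fraction `c·K ≤ K − j⋆(K)`, NE7b's output shape
`RelWeightBound` holds with the bad classes emptied below some `K₁ ≥ K₀` and
`W = 𝟙_{K ≥ K₁}·Cst·Nanc·ϱ^{K−j⋆(K)+1}/(1−ϱ)`, `ϱ = Δ₁·e^{−(survivalRate − c₃)} < 1`.  The survival condition has been
ABSORBED into `x₀`.  NOT a proof of NE7b: the readings, BetaPertH behind the flow facts, and (B) inside `LowEnvelope`
stay displayed. [folklore] -/
theorem exists_irThreshold_relWeightBound (C₀ : T4PrintedShapeBanking.Consts) (hC₀ : C₀.Valid) (ha : 0 < C₀.a)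
    (hA : 0 < C₀.A₀) {L r : ℕ} (hL : 1 ≤ L) {β₀ : ℝ} (hβ : 0 ≤ β₀) (hrq : r * (C₀.q' + 1) < C₀.p₀)
    {Δ₁ cA cB dC : ℝ} (hΔ₁ : 0 < Δ₁) (hcA : 0 < cA) (hcB : 0 < cB) (hdC : 0 ≤ dC) (c₃ : ℝ) :
    ∃ x₀ : ℝ, ∀ (l₀ : ℝ) (T : ℕ → Finset ι) (A B : ℕ → ℝ → ι → ℝ) (Bad : ℕ → ℝ → Finset ι)
      (nup mup nlow mlow : ℕ → ℝ → ℝ) (Cst : ℝ) (K₀ : ℕ) (jstar : ℕ → ℕ) (Nanc c : ℝ),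
      (∀ K t, |t| ≤ l₀ → K₀ ≤ K → RunReadingsFlow (withBanks C₀ (survivalRate Δ₁ c₃) (2 * cA) (cB + 2 * cA * dC))
        L r β₀ x₀ T A Bad nup jstar Δ₁ Nanc cA cB dC c₃ K t) →
      (∀ K t, |t| ≤ l₀ → K₀ ≤ K → RunReadingsFlow (withBanks C₀ (survivalRate Δ₁ c₃) (2 * cA) (cB + 2 * cA * dC))
        L r β₀ x₀ T B Bad mup jstar Δ₁ Nanc cA cB dC c₃ K t) →
      LowEnvelope l₀ T A nlow nup Cst K₀ → LowEnvelope l₀ T B mlow mup Cst K₀ → 0 ≤ Cst →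
      (∀ K, jstar K ≤ K) → 0 ≤ Nanc → 0 < c → (∀ K : ℕ, c * K ≤ ((K - jstar K : ℕ) : ℝ)) →
      ∃ K₁, K₀ ≤ K₁ ∧ RelWeightBound l₀ T A B (fun K t => if K₁ ≤ K then Bad K t else ∅)
        (Set.indicator {K | K₁ ≤ K} (fun K => Cst *
          contourBudget Nanc (Δ₁ * Real.exp (-(survivalRate Δ₁ c₃ - c₃))) jstar K)) := by
  have hC₁ : 0 < 2 * cA := by positivity
  have hC₂ : 0 < cB + 2 * cA * dC := by positivity
  obtain ⟨hV, -, x₀, hx₀⟩ := survival_and_irThreshold C₀ hC₀ ha hA hL hβ hrq (Δ₁ := Δ₁) (c₃ := c₃) hΔ₁ hC₁ hC₂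
  set C := withBanks C₀ (survivalRate Δ₁ c₃) (2 * cA) (cB + 2 * cA * dC) with hC
  have hrate : rateB C.κ₁ C.Eb C.μ (2 * cA) (cB + 2 * cA * dC) = survivalRate Δ₁ c₃ := rateB_withBanks hC₁ hC₂
  have hA0 : 0 ≤ C.A₀ := hA.le
  refine ⟨x₀, ?_⟩
  intro l₀ T A B Bad nup mup nlow mlow Cst K₀ jstar Nanc c hRA hRB hEA hEB hCst hj hNanc hc hfrac
  -- the flow facts give the banking; so `RunReadingsFlow` gives `RunReadings`
  have toRun : ∀ {X : ℕ → ℝ → ι → ℝ} {xup : ℕ → ℝ → ℝ} {K : ℕ} {t : ℝ},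
      RunReadingsFlow C L r β₀ x₀ T X Bad xup jstar Δ₁ Nanc cA cB dC c₃ K t →
        RunReadings C T X Bad xup jstar Δ₁ Nanc cA cB dC c₃ K t := by
    intro X xup K t h
    obtain ⟨Cell, hF, hD, M, hR, Δ, Kc, R, g, β', hT, h27, h29, hRj, hx1, hxK, hL'⟩ := h
    refine ⟨Cell, hF, hD, M, hR, Δ, Kc, R, g, hT, fun s hs => by linarith [hx1 s hs], ?_, hL'⟩
    exact hx₀ Kc R g β' h27 h29 hRj hx1 hxK
  have key := exists_relWeightBound_of_readings (C := C) hV hA0 hcA hcB hdC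
    (fun K t ht hK => toRun (hRA K t ht hK)) (fun K t ht hK => toRun (hRB K t ht hK))
    hEA hEB hCst hj hNanc hΔ₁ (by rw [hrate]; exact lt_survivalRate Δ₁ c₃) hc hfrac
  rw [hrate] at key
  exact key

end Flow

/-! ## §3 The entropy fields on the torus cell complex -/

section Torus

open scoped Classical

variable {d n L K' : ℕ}

/-- On the space-time cell complex `STCell d n L K'` of a cutoff-`K'` run (adjacency `stGraph`, scale `sc`), the
cells of a scale `K ≤ K'` number at most `(n · L^{K'−K})^d` (`= n^d` for run A, `K' = K`; `(nL)^d` for run B,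
`K' = K + 1`). [folklore] -/
theorem card_scale_le (hL : 1 ≤ L) {K : ℕ} (hK : K ≤ K') :
    ((univ : Finset (STCell d n L K')).filter fun w => w.sc = K).card ≤ (n * L ^ (K' - K)) ^ d := by
  have h := card_filter_scale_le (d := d) (n := n) (L := L) (K := K') K (ZoneTorus.IsScale L K)
  have hset : ((univ : Finset (STCell d n L K')).filter fun w => w.sc = K)
      = (univ : Finset (STCell d n L K')).filter fun w => w.sc = K ∧ ZoneTorus.IsScale L K w.pt := by
    refine filter_congr fun w _ => ⟨fun hw => ⟨hw, ?_⟩, fun hw => hw.1⟩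
    have := w.2
    rw [show w.1.1.val = K from hw] at this
    exact this
  rw [hset]
  refine h.trans ?_
  have hc := ZoneTorus.card_cellsAt (d := d) n hL hK
  rw [ZoneTorus.cellsAt] at hc
  exact hc.le

/-- **THE ENTROPY FIELDS ARE KERNEL ON THE TORUS**: an occupancy model whose cells are the space-time cells
`STCell d n L K'`, whose adjacency is `stGraph` and whose scale is `sc` satisfies `deg` with `Δ = 3^d + L^d + 1`
(`degree_stGraph_le`), `animal` with `Δ₁ = (Δ + 1)²` (`siteAnimalBound_sq`) and `anchors` with
`Nanc = (n·L^{K'−K})^d` — so only `nonneg`, `cover` and `lineage` of `LineageReadings` remain to be read.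
[folklore] -/
theorem lineageReadings_torus {ι : Type*} (hL : 1 ≤ L) {K : ℕ} (hK : K ≤ K') {T : Finset ι}
    {Occ : ι → Finset (STCell d n L K')} {C : T4PrintedShapeBanking.Consts} {Kc : ℕ} {R : ℕ → ℕ} {g : ℕ → ℝ}
    {A : ι → ℝ} {Bad : Finset ι} {jlo : ℕ} {nup cA cB dC c₃ : ℝ}
    (hnonneg : ∀ τ ∈ T, 0 ≤ A τ)
    (hcover : (⟨T, Occ, stGraph d n L K', STCell.sc⟩ : OccModel ι (STCell d n L K')).ContourCover Bad jlo K)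
    (hlin : letI M : OccModel ι (STCell d n L K') := ⟨T, Occ, stGraph d n L K', STCell.sc⟩
      ∃ (gen : ι → Finset (STCell d n L K') → Gen PEv) (rest : Finset (STCell d n L K') → ι → ℝ)
        (tcut : ι → Finset (STCell d n L K') → ℕ),
      (∀ (𝒦 : Finset (STCell d n L K')), ∀ τ ∈ M.T, M.IsContour τ 𝒦 →
          Consistent C Kc R (gen τ 𝒦) ∧ (gen τ 𝒦).WF (dictW R C.n₁) ∧
          tcut τ 𝒦 ≤ (gen τ 𝒦).reach (dictW R C.n₁) ∧
          (𝒦.card : ℝ) ≤ cA * treeD PEv.fat PEv.step dC (gen τ 𝒦) (tcut τ 𝒦) +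
            cB * treeSteps PEv.step (gen τ 𝒦) (tcut τ 𝒦) ∧
          A τ ≤ Real.exp (-(credits (credit C g) (gen τ 𝒦) -
            lifeCost (dictW R C.n₁) (cost C Kc R) (gen τ 𝒦))) * rest 𝒦 τ) ∧
      (∀ (𝒦 : Finset (STCell d n L K')), ∀ τ ∈ M.T, 0 ≤ rest 𝒦 τ) ∧
      (∀ (𝒦 : Finset (STCell d n L K')),
        ∑ τ ∈ M.T.filter (fun τ => M.IsContour τ 𝒦), rest 𝒦 τ ≤ Real.exp c₃ ^ 𝒦.card * nup)) :
    LineageReadings (⟨T, Occ, stGraph d n L K', STCell.sc⟩ : OccModel ι (STCell d n L K')) C K Kc R g A Bad jlo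
      nup (3 ^ d + L ^ d + 1) ((((3 ^ d + L ^ d + 1 : ℕ) : ℝ) + 1) ^ 2) (((n * L ^ (K' - K)) ^ d : ℕ) : ℝ)
      cA cB dC c₃ where
  deg := degree_stGraph_le hL
  animal := siteAnimalBound_sq (3 ^ d + L ^ d + 1)
  anchors := by exact_mod_cast card_scale_le hL hK
  nonneg := hnonneg
  cover := hcover
  lineage := hlin

end Torus

end

end Summit.QuantumFields.BalabanUV.T4Continuum.SpaceTimePeierls
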